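import Summits.AtomisticToContinuum.HydrodynamicLimit.Theorems.JaynesSqueezeHardSphereLDAConvexity
import Mathlib.MeasureTheory.Function.ContinuousMapDense
import HarnessLib

/-!
# Hard-sphere local density approximation, VIIa: continuous approximation of measurable densities

Helper file for the support item `HardSphereLDA` (stmt-AtomisticToContinuum-13459) of route
`JaynesSqueeze`. Tools for passing from continuous to measurable density profiles:

* `exists_continuous_approx` — a measurable unit-mass density `c ≤ ρ ≤ M` on `𝕋³` is, for every
  `δ ∈ (0, 1/2]`, within `2δ` in `L¹` of a CONTINUOUS unit-mass density with `c/2 ≤ ρ′ ≤ 2M`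
  (density of continuous functions in `L¹(𝕋³)` — Mathlib's
  `Integrable.exists_boundedContinuous_integral_sub_le` —, clamping to the band, renormalising);
* `measurable_comp_of_continuousOn` — `g ∘ ρ` is measurable when `g` is continuous on a set
  containing the range of the measurable `ρ`;
* `posPartition_mono`, `posPartition_pos_of_ge` — monotonicity of the configurational partition
  function in the activity, hence positivity for measurable activities bounded below;
* `exists_one_le_of_integral_eq_one'` — a unit-mass density reaches `1`.

No definitions. prover-pitem-stmt-AtomisticToContinuum-13459-0.
-/

noncomputable section

namespace Summit.AtomisticToContinuum.HydrodynamicLimit.Theorems.HardSphereLDA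

open MeasureTheory Filter Set Topology
open scoped ENNReal BoundedContinuousFunction
open Literature.MathematicalPhysics.KineticTheory Literature.Analysis.FluidPDE

/-! ### Measurability through a continuous-on-the-range function -/

/-- If `g` is continuous on a set containing the range of a measurable `ρ`, then `g ∘ ρ` is
measurable. [folklore] -/
theorem measurable_comp_of_continuousOn {α : Type*} [MeasurableSpace α] {ρ : α → ℝ} {g : ℝ → ℝ}
    {s : Set ℝ} (hg : ContinuousOn g s) (hρ : Measurable ρ) (hmem : ∀ x, ρ x ∈ s) :
    Measurable fun x => g (ρ x) := by
  have h : (fun x => g (ρ x)) = s.restrict g ∘ fun x => (⟨ρ x, hmem x⟩ : s) := by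
    funext x; rfl
  rw [h]
  exact (continuousOn_iff_continuous_restrict.1 hg).measurable.comp hρ.subtype_mk

/-- A bounded measurable unit-mass density on `𝕋³` reaches `1`: `∃ x, 1 ≤ ρ(x)`. [folklore] -/
theorem exists_one_le_of_integral_eq_one' {ρ : T3 → ℝ} (hρi : Integrable ρ) (hρ1 : (∫ x, ρ x) = 1) :
    ∃ x, 1 ≤ ρ x := by
  by_contra hcon
  push Not at hcon
  have hpos : 0 < ∫ x, (1 - ρ x) := by
    rw [integral_pos_iff_support_of_nonneg (fun x => sub_nonneg.2 (hcon x).le) ((integrable_const 1).sub hρi)]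
    have hsupp : Function.support (fun x => 1 - ρ x) = univ :=
      eq_univ_of_forall fun x => (sub_pos.2 (hcon x)).ne'
    rw [hsupp, measure_univ]
    exact one_pos
  rw [integral_sub (integrable_const 1) hρi, integral_const, smul_eq_mul, probReal_univ, hρ1] at hpos
  linarith

/-- **Monotonicity of the partition function in the activity**: `0 ≤ a ≤ a′` (measurable, `a′`
bounded) gives `Z(a) ≤ Z(a′)`. [folklore] -/
theorem posPartition_mono {a a' : T3 → ℝ} (ha' : Measurable a') (ha0 : ∀ y, 0 ≤ a y)
    (hle : ∀ y, a y ≤ a' y) {A : ℝ} (hA : ∀ y, a' y ≤ A) (ε : ℝ) (n : ℕ) :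
    posPartition a ε n ≤ posPartition a' ε n := by
  have ha0' : ∀ y, 0 ≤ a' y := fun y => (ha0 y).trans (hle y)
  refine integral_mono_of_nonneg (Eventually.of_forall fun x => posWeight_nonneg ha0 ε x)
    (integrable_config_of_abs_le (measurable_posWeight_of_measurable ha' ε n) (abs_posWeight_le ha0' hA ε))
    (Eventually.of_forall fun x => ?_)
  unfold posWeight
  by_cases hx : x ∈ posDomain ε n
  · simp only [indicator_of_mem hx]
    exact Finset.prod_le_prod (fun i _ => ha0 _) fun i _ => hle _
  · simp only [indicator_of_notMem hx, le_refl]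

/-- The partition function of a measurable activity bounded below by a positive constant is positive
(`σ ≤ 1/2`). [folklore] -/
theorem posPartition_pos_of_ge {a : T3 → ℝ} (ha : Measurable a) {m A : ℝ} (hm : 0 < m) (hma : ∀ y, m ≤ a y)
    (hA : ∀ y, a y ≤ A) {σ : ℝ} (hσ2 : σ ≤ 1 / 2) (N : ℕ) :
    0 < posPartition a (hsDiameter σ N) (N + 1) := by
  have h1 : 0 < posPartition (fun _ => m) (hsDiameter σ N) (N + 1) :=
    posPartition_pos continuous_const (fun _ => hm) hσ2 N
  exact h1.trans_le (posPartition_mono ha (fun _ => hm.le) hma hA _ _)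

/-! ### Continuous approximation of measurable densities in a band -/

/-- **Continuous unit-mass approximation in a band.** A measurable density `ρ` on `𝕋³` with
`c ≤ ρ ≤ M` (`0 < c`) and unit mass is, for every `δ ∈ (0, 1/2]`, within `2δ` in `L¹` of a CONTINUOUS
unit-mass density `ρ′` with `c/2 ≤ ρ′ ≤ 2M` (density of continuous functions in `L¹`, clamping to
`[c, M]`, renormalising). [folklore] -/
theorem exists_continuous_approx {ρ : T3 → ℝ} (hρm : Measurable ρ) {c M : ℝ} (hc : 0 < c)
    (hρc : ∀ x, c ≤ ρ x) (hρM : ∀ x, ρ x ≤ M) (hρ1 : (∫ x, ρ x) = 1) {δ : ℝ} (hδ : 0 < δ) (hδ2 : δ ≤ 1 / 2) :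
    ∃ ρ' : T3 → ℝ, Continuous ρ' ∧ (∀ x, c / 2 ≤ ρ' x) ∧ (∀ x, ρ' x ≤ 2 * M) ∧ (∫ x, ρ' x) = 1 ∧
      (∫ x, |ρ' x - ρ x|) ≤ 2 * δ := by
  have hcM : c ≤ M := (hρc 0).trans (hρM 0)
  have hρi : Integrable ρ := Integrable.of_bound hρm.aestronglyMeasurable M
    (Eventually.of_forall fun x => by rw [Real.norm_eq_abs, abs_of_pos (hc.trans_le (hρc x))]; exact hρM x)
  -- a continuous `L¹`-approximation
  obtain ⟨g, hg, hgi⟩ := hρi.exists_boundedContinuous_integral_sub_le hδ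
  -- clamp it to the band
  set g₁ : T3 → ℝ := fun x => max c (min M (g x)) with hg₁
  have hg₁c : Continuous g₁ := continuous_const.max (continuous_const.min g.continuous)
  have hg₁lo : ∀ x, c ≤ g₁ x := fun x => le_max_left _ _
  have hg₁hi : ∀ x, g₁ x ≤ M := fun x => max_le hcM (min_le_left _ _)
  have hg₁close : ∀ x, |g₁ x - ρ x| ≤ |g x - ρ x| := by
    intro x
    rw [hg₁]; dsimp only
    have h1 := hρc x; have h2 := hρM x
    rcases le_total (g x) c with hgc | hgc
    · rw [min_eq_right (hgc.trans hcM), max_eq_left hgc, abs_of_nonpos (by linarith), abs_of_nonpos (by linarith)]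
      linarith
    · rcases le_total M (g x) with hgM | hgM
      · rw [min_eq_left hgM, max_eq_right hcM, abs_of_nonneg (by linarith), abs_of_nonneg (by linarith)]
        linarith
      · rw [min_eq_right hgM, max_eq_right hgc]
  have hg₁i : Integrable g₁ := integrable_of_continuous_T3 hg₁c
  have hdiff_i : Integrable fun x => |g₁ x - ρ x| := (hg₁i.sub hρi).abs
  have hL1 : (∫ x, |g₁ x - ρ x|) ≤ δ := by
    calc (∫ x, |g₁ x - ρ x|) ≤ ∫ x, ‖ρ x - g x‖ := by
          refine integral_mono hdiff_i (hρi.sub hgi).norm fun x => ?_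
          dsimp only
          rw [Real.norm_eq_abs, abs_sub_comm (ρ x) (g x)]; exact hg₁close x
      _ ≤ δ := hg
  -- its mass is close to `1`
  have hmass : |(∫ x, g₁ x) - 1| ≤ δ := by
    have e : (∫ x, g₁ x) - 1 = ∫ x, (g₁ x - ρ x) := by rw [integral_sub hg₁i hρi, hρ1]
    rw [e]
    exact (abs_integral_le_integral_abs).trans hL1
  have hmlo : 1 / 2 ≤ ∫ x, g₁ x := by have := (abs_le.1 hmass).1; linarith
  have hmhi : (∫ x, g₁ x) ≤ 3 / 2 := by have := (abs_le.1 hmass).2; linarith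
  have hm0 : 0 < ∫ x, g₁ x := by linarith
  -- renormalise
  refine ⟨fun x => g₁ x / ∫ y, g₁ y, hg₁c.div_const _, fun x => ?_, fun x => ?_, ?_, ?_⟩
  · rw [le_div_iff₀ hm0]
    nlinarith [hg₁lo x]
  · rw [div_le_iff₀ hm0]
    nlinarith [hg₁hi x, hc.trans_le (hg₁lo x)]
  · rw [integral_div, div_self hm0.ne']
  · have hsplit : ∀ x, |g₁ x / (∫ y, g₁ y) - ρ x| ≤ |1 - ∫ y, g₁ y| / (∫ y, g₁ y) * g₁ x + |g₁ x - ρ x| := by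
      intro x
      have e : g₁ x / (∫ y, g₁ y) - ρ x = (1 - ∫ y, g₁ y) / (∫ y, g₁ y) * g₁ x + (g₁ x - ρ x) := by
        field_simp
        ring
      rw [e]
      refine (abs_add_le _ _).trans (add_le_add (le_of_eq ?_) le_rfl)
      rw [abs_mul, abs_div, abs_of_pos hm0, abs_of_pos (hc.trans_le (hg₁lo x))]
    have hi1 : Integrable fun x => |1 - ∫ y, g₁ y| / (∫ y, g₁ y) * g₁ x + |g₁ x - ρ x| :=
      (hg₁i.const_mul _).add hdiff_i
    calc (∫ x, |g₁ x / (∫ y, g₁ y) - ρ x|)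
        ≤ ∫ x, |1 - ∫ y, g₁ y| / (∫ y, g₁ y) * g₁ x + |g₁ x - ρ x| :=
          integral_mono_of_nonneg (Eventually.of_forall fun x => abs_nonneg _) hi1 (Eventually.of_forall hsplit)
      _ = |1 - ∫ y, g₁ y| + ∫ x, |g₁ x - ρ x| := by
          rw [integral_add (hg₁i.const_mul _) hdiff_i, integral_const_mul, div_mul_cancel₀ _ hm0.ne']
      _ ≤ δ + δ := add_le_add (by rw [abs_sub_comm]; exact hmass) hL1
      _ = 2 * δ := by ring

end Summit.AtomisticToContinuum.HydrodynamicLimit.Theorems.HardSphereLDA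

end
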